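import Summits.AnomalousDissipation.AnomalousDissipation.Theorems.TwoAndHalfDScalarAnomalySteadySourceFormalReleaseGradientGrowth
import Summits.AnomalousDissipation.AnomalousDissipation.Theorems.TwoAndHalfDScalarAnomalySteadySourceFormalColdStartVariance
import HarnessLib

/-!
# Poon's `L²` floor for releases under a Lipschitz drift (tool stub `stub_releaseL2Floor`)

Crux `TwoAndHalfD.ScalarAnomalySteadySourceFormal` (stmt-AnomalousDissipation-0448), line
`budgeted-mixer-template`, lead's tool file. For a classical solution `φ` of `∂ₜφ + u·∇φ = κΔφ`
(`κ ≥ 0`) on `[a, b]` over a smooth divergence-free drift whose velocity gradient is bounded in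
quadratic form by `Λ(t)`, the landed gradient-growth bound
`‖∇φ(r)‖² ≤ ‖∇φ(a)‖² exp(2∫ₐʳ Λ)` (`ReleaseGradientGrowth.scalarGradNormSq_le_mul_exp`, p116474) and
the `L²` balance `‖φ(t)‖² + 2κ∫ₐᵗ‖∇φ‖² = ‖φ(a)‖²`
(`IsClassicalScalarTransportOn.scalarL2Sq_add_scalarDissipation_holds`) give the DIRICHLET-QUOTIENT
FLOOR `‖φ(t)‖² ≥ ‖φ(a)‖² − 2κ‖∇φ(a)‖² ∫ₐᵗ exp(2∫ₐʳ Λ) dr` (Poon, Comm. PDE 21 (1996); Miles–Doering,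
Nonlinearity 31 (2018) §2; Coti Zelati–Delgadino–Elgindi, CPAM 73 (2020) §2). Read contrapositively
this is the per-window super-Lipschitz NECESSITY for every witness of the line's open stub S1'
(`stub_profileMixerRealizable`): a release of `h` that loses three quarters of its `L²` mass
through diffusivity `ν_j` within time `τ` needs `∫ₛ^{s+τ} Λ_j ≳ ½ log(1/ν_j)` (drefute NC3).

* `scalarL2Sq_sub_le` — the floor with implicit binders;
* `scalarL2Sq_sub_le_of_const`, `quartering_lipschitz_floor` — the uniformly-Lipschitz form and its
  reading "quartering in time `τ` needs `(3/4)‖φ(a)‖² ≤ 2κτe^{2Λ₀τ}‖∇φ(a)‖²`";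
* `decay_clause_not_uniformlyLipschitz` — the (Decay) clause of the line's residual S1'
  (`stub_profileMixerRealizable`) is incompatible with velocity gradients bounded uniformly in `j`;
* `stub_releaseL2Floor` — the registered signature.
-/

noncomputable section

namespace Summit.AnomalousDissipation.AnomalousDissipation.Theorems.ScalarAnomalySteadySourceFormal.ReleaseL2Floor

open MeasureTheory Filter Topology Set
open scoped ENNReal NNReal RealInnerProductSpace InnerProductSpace
open Literature.Analysis.FunctionSpaces Literature.Analysis.FluidPDE
open Summit.AnomalousDissipation.AnomalousDissipation.Theorems.ScalarAnomalySteadySourceFormal.ReleaseGradientGrowth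

-- the summit's namespace `Summit.AnomalousDissipation.AnomalousDissipation.…` repeats the problem name by design (D-0017)
set_option linter.dupNamespace false

variable {κ a b : ℝ} {u : ℝ → UnitAddTorus (Fin 2) → EuclideanSpace ℝ (Fin 2)}
  {φ : ℝ → UnitAddTorus (Fin 2) → ℝ} {Λ : ℝ → ℝ}

/-- **Poon's `L²` floor.** Under the gradient-growth hypotheses,
`‖φ(a)‖² − 2κ‖∇φ(a)‖² ∫ₐᵗ exp(2∫ₐʳΛ) dr ≤ ‖φ(t)‖²` for `t ∈ [a, b]`: the `L²` balance
`‖φ(t)‖² = ‖φ(a)‖² − 2κ∫ₐᵗ‖∇φ(r)‖² dr` and the pointwise bound `‖∇φ(r)‖² ≤ ‖∇φ(a)‖² exp(2∫ₐʳΛ)`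
under a monotone interval integral. [folklore; Poon 1996, Miles–Doering 2018 §2] -/
theorem scalarL2Sq_sub_le (hκ : 0 ≤ κ) (hab : a < b)
    (h : Torus.IsClassicalScalarTransportOn (Icc a b) κ u φ) (hΛ : ContinuousOn Λ (Icc a b))
    (hΛb : ∀ t ∈ Icc a b, ∀ (x : UnitAddTorus (Fin 2)) (ξ : EuclideanSpace ℝ (Fin 2)),
      |⟪ξ, Torus.fderiv (u t) x ξ⟫_ℝ| ≤ Λ t * ‖ξ‖ ^ 2)
    {t : ℝ} (ht : t ∈ Icc a b) :
    Torus.scalarL2Sq (φ a) - 2 * κ * Torus.scalarGradNormSq (φ a) *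
        ∫ r in a..t, Real.exp (2 * ∫ τ in a..r, Λ τ) ≤ Torus.scalarL2Sq (φ t) := by
  -- the `L²` balance on `[a, t]`
  have hbal := Torus.IsClassicalScalarTransportOn.scalarL2Sq_add_scalarDissipation_holds h ht.1
    (Icc_subset_Icc le_rfl ht.2)
  -- pointwise gradient bound on `[a, t]`
  have hgrad : ∀ r ∈ Icc a t, Torus.scalarGradNormSq (φ r) ≤
      Torus.scalarGradNormSq (φ a) * Real.exp (2 * ∫ τ in a..r, Λ τ) := fun r hr =>
    scalarGradNormSq_le_mul_exp hκ hab h hΛ hΛb ⟨hr.1, hr.2.trans ht.2⟩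
  -- continuity of both sides on `[a, t]`
  have hcontE : ContinuousOn (fun r => Torus.scalarGradNormSq (φ r)) (Icc a t) :=
    (continuousOn_scalarGradNormSq hab h).mono (Icc_subset_Icc le_rfl ht.2)
  have hcontI : ContinuousOn (fun r => ∫ τ in a..r, Λ τ) (Icc a b) := by
    have hint : IntervalIntegrable Λ volume a b :=
      (hΛ.mono (by rw [uIcc_of_le hab.le])).intervalIntegrable
    have := intervalIntegral.continuousOn_primitive_interval' hint left_mem_uIcc
    rwa [uIcc_of_le hab.le] at this
  have hcontX : ContinuousOn
      (fun r => Torus.scalarGradNormSq (φ a) * Real.exp (2 * ∫ τ in a..r, Λ τ)) (Icc a t) := by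
    refine continuousOn_const.mul ?_
    refine ((continuousOn_const.mul (hcontI.mono (Icc_subset_Icc le_rfl ht.2))).rexp)
  have hmono : ∫ r in a..t, Torus.scalarGradNormSq (φ r) ≤
      ∫ r in a..t, Torus.scalarGradNormSq (φ a) * Real.exp (2 * ∫ τ in a..r, Λ τ) :=
    intervalIntegral.integral_mono_on ht.1
      (hcontE.mono (by rw [uIcc_of_le ht.1])).intervalIntegrable
      (hcontX.mono (by rw [uIcc_of_le ht.1])).intervalIntegrable hgrad
  rw [intervalIntegral.integral_const_mul] at hmono
  simp only [Torus.scalarDissipation] at hbal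
  have hκ' : 2 * κ * ∫ r in a..t, Torus.scalarGradNormSq (φ r) ≤
      2 * κ * (Torus.scalarGradNormSq (φ a) * ∫ r in a..t, Real.exp (2 * ∫ τ in a..r, Λ τ)) :=
    mul_le_mul_of_nonneg_left hmono (by positivity)
  nlinarith [hbal, hκ']

/-- **Uniform-Lipschitz form of the floor.** If the velocity gradient is bounded in quadratic form by
a CONSTANT `Λ₀ ≥ 0` on `[a, b]`, then `‖φ(a)‖² − 2κ (t − a) e^{2Λ₀(t−a)} ‖∇φ(a)‖² ≤ ‖φ(t)‖²`
(bound the inner integral `∫ₐʳ Λ₀ = Λ₀(r − a) ≤ Λ₀(t − a)` and the outer one by `(t − a)·sup`).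
[folklore; Poon 1996, Miles–Doering 2018 §2] -/
theorem scalarL2Sq_sub_le_of_const {Λ₀ : ℝ} (hκ : 0 ≤ κ) (hab : a < b) (hΛ₀ : 0 ≤ Λ₀)
    (h : Torus.IsClassicalScalarTransportOn (Icc a b) κ u φ)
    (hΛb : ∀ t ∈ Icc a b, ∀ (x : UnitAddTorus (Fin 2)) (ξ : EuclideanSpace ℝ (Fin 2)),
      |⟪ξ, Torus.fderiv (u t) x ξ⟫_ℝ| ≤ Λ₀ * ‖ξ‖ ^ 2)
    {t : ℝ} (ht : t ∈ Icc a b) :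
    Torus.scalarL2Sq (φ a) - 2 * κ * (t - a) * Real.exp (2 * Λ₀ * (t - a)) *
        Torus.scalarGradNormSq (φ a) ≤ Torus.scalarL2Sq (φ t) := by
  have hfloor := scalarL2Sq_sub_le (Λ := fun _ => Λ₀) hκ hab h continuousOn_const hΛb ht
  -- bound `∫ₐᵗ exp(2∫ₐʳ Λ₀) dr ≤ (t - a) exp(2Λ₀(t - a))`
  have hinner : ∀ r, (∫ _τ in a..r, Λ₀) = (r - a) * Λ₀ := fun r => by
    rw [intervalIntegral.integral_const, smul_eq_mul]
  simp_rw [hinner] at hfloor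
  have hexp_le : ∀ r ∈ Icc a t, Real.exp (2 * ((r - a) * Λ₀)) ≤ Real.exp (2 * Λ₀ * (t - a)) := by
    intro r hr
    apply Real.exp_le_exp.2
    have : (r - a) * Λ₀ ≤ (t - a) * Λ₀ := mul_le_mul_of_nonneg_right (by linarith [hr.2]) hΛ₀
    nlinarith
  have hint : ∫ r in a..t, Real.exp (2 * ((r - a) * Λ₀)) ≤ (t - a) * Real.exp (2 * Λ₀ * (t - a)) := by
    have hcont : Continuous fun r => Real.exp (2 * ((r - a) * Λ₀)) := by fun_prop
    calc ∫ r in a..t, Real.exp (2 * ((r - a) * Λ₀))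
        ≤ ∫ _r in a..t, Real.exp (2 * Λ₀ * (t - a)) :=
          intervalIntegral.integral_mono_on ht.1 (hcont.intervalIntegrable _ _)
            (continuous_const.intervalIntegrable _ _) hexp_le
      _ = (t - a) * Real.exp (2 * Λ₀ * (t - a)) := by
          rw [intervalIntegral.integral_const, smul_eq_mul]
  have hnn : 0 ≤ 2 * κ * Torus.scalarGradNormSq (φ a) := by
    have := Torus.scalarGradNormSq_nonneg (φ a)
    positivity
  have := mul_le_mul_of_nonneg_left hint hnn
  nlinarith [hfloor, this]

/-- **Quartering needs a logarithmic Lipschitz budget (drefute NC3, certified form).** If, under a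
constant quadratic-form bound `Λ₀ ≥ 0` on the velocity gradient over `[a, b]`, a classical release
loses three quarters of its `L²` mass by time `a + τ ≤ b`, then
`(3/4)‖φ(a)‖² ≤ 2κτ e^{2Λ₀τ} ‖∇φ(a)‖²`; for a fixed smooth profile `φ(a) = h ≠ 0` and `κ = ν_j → 0`
this forces `Λ₀ ≥ (2τ)⁻¹ log(3‖h‖²/(8ν_jτ‖∇h‖²)) → ∞`: no uniformly Lipschitz family realises the
(Decay) clause of S1' `stub_profileMixerRealizable`. [folklore; Poon 1996, Miles–Doering 2018 §2] -/
theorem quartering_lipschitz_floor {Λ₀ τ : ℝ} (hκ : 0 ≤ κ) (hab : a < b) (hΛ₀ : 0 ≤ Λ₀)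
    (h : Torus.IsClassicalScalarTransportOn (Icc a b) κ u φ)
    (hΛb : ∀ t ∈ Icc a b, ∀ (x : UnitAddTorus (Fin 2)) (ξ : EuclideanSpace ℝ (Fin 2)),
      |⟪ξ, Torus.fderiv (u t) x ξ⟫_ℝ| ≤ Λ₀ * ‖ξ‖ ^ 2)
    (hτ : 0 ≤ τ) (hτb : a + τ ≤ b)
    (hquarter : Torus.scalarL2Sq (φ (a + τ)) ≤ 4⁻¹ * Torus.scalarL2Sq (φ a)) :
    3 / 4 * Torus.scalarL2Sq (φ a) ≤
      2 * κ * τ * Real.exp (2 * Λ₀ * τ) * Torus.scalarGradNormSq (φ a) := by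
  have ht : a + τ ∈ Icc a b := ⟨by linarith, hτb⟩
  have hfloor := scalarL2Sq_sub_le_of_const hκ hab hΛ₀ h hΛb ht
  simp only [add_sub_cancel_left] at hfloor
  linarith

/-- **No uniformly Lipschitz realisation of the (Decay) clause of S1'.** Let `ν_j > 0`, `ν_j → 0`,
let the drifts `v_j` be jointly smooth and divergence free on `[0, ∞) × T²`, let `h` be a smooth
profile with `‖h‖_{L²} ≠ 0`, and let `ρm ≥ 0` be an antitone majorant with `∫₀ᵗ ρm ≤ R` (`t ≥ 0`)
such that every classical release of `h` from a start time `s ≥ 0` obeys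
`‖φ(t)‖² ≤ ρm(t − s)²‖h‖²` — the (Decay) clause of `stub_profileMixerRealizable`, for every `j`.
Then the velocity gradients are NOT bounded in quadratic form by any constant `Λ₀` uniformly in
`j`, `t ≥ 0`, `x`: at the lag `τ = 2R + 1` the majorant has dropped below `1/2`
(`τ ρm(τ) ≤ ∫₀^τ ρm ≤ R`), so the release of `h` from time `0` (which exists,
`ColdStartVariance.exists_release`) is quartered, and `quartering_lipschitz_floor` gives
`(3/4)‖h‖² ≤ ν_j · 2τe^{2Λ₀τ}‖∇h‖²` for every `j`, absurd as `ν_j → 0`. This is the uniformly-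
Lipschitz (`sup_j ‖∇v_j‖_∞ < ∞`) no-go for the line's residual, i.e. drefute NC3 / Disproof §5(e)
restricted to `L²`-decay witnesses, kernel-checked. [folklore; Poon 1996, Miles–Doering 2018 §2] -/
theorem decay_clause_not_uniformlyLipschitz {ν : ℕ → ℝ}
    {v : ℕ → ℝ → UnitAddTorus (Fin 2) → EuclideanSpace ℝ (Fin 2)} {h : UnitAddTorus (Fin 2) → ℝ}
    {ρm : ℝ → ℝ} {R Λ₀ : ℝ}
    (hν : ∀ j, 0 < ν j) (hν0 : Tendsto ν atTop (𝓝 0))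
    (hv : ∀ j, Torus.IsSmoothSpaceTimeOn (Ici 0) (v j))
    (hdiv : ∀ j, ∀ t ∈ Ici (0 : ℝ), Torus.IsDivFree (v j t))
    (hh : Torus.IsSmooth h) (hh0 : Torus.scalarL2Sq h ≠ 0)
    (hanti : Antitone ρm) (hnn : ∀ r, 0 ≤ ρm r) (hR : ∀ t, 0 ≤ t → ∫ r in (0 : ℝ)..t, ρm r ≤ R)
    (hDecay : ∀ j (s T' : ℝ), 0 ≤ s → ∀ φ : ℝ → UnitAddTorus (Fin 2) → ℝ,
      Torus.IsClassicalScalarTransportOn (Icc s T') (ν j) (v j) φ → φ s = h →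
      ∀ t ∈ Icc s T', Torus.scalarL2Sq (φ t) ≤ ρm (t - s) ^ 2 * Torus.scalarL2Sq h)
    (hΛ₀ : 0 ≤ Λ₀)
    (hLip : ∀ j, ∀ t ∈ Ici (0 : ℝ), ∀ (x : UnitAddTorus (Fin 2)) (ξ : EuclideanSpace ℝ (Fin 2)),
      |⟪ξ, Torus.fderiv (v j t) x ξ⟫_ℝ| ≤ Λ₀ * ‖ξ‖ ^ 2) : False := by
  have hR0 : 0 ≤ R := by simpa using hR 0 le_rfl
  set τ : ℝ := 2 * R + 1 with hτ_def
  have hτ : 0 < τ := by rw [hτ_def]; linarith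
  have hh_pos : 0 < Torus.scalarL2Sq h := lt_of_le_of_ne (Torus.scalarL2Sq_nonneg h) (Ne.symm hh0)
  -- the majorant at lag `τ` is below `1/2`
  have hρτ : ρm τ ≤ 1 / 2 := by
    have hint : IntervalIntegrable ρm volume 0 τ := hanti.intervalIntegrable
    have hlow : ∫ _r in (0 : ℝ)..τ, ρm τ ≤ ∫ r in (0 : ℝ)..τ, ρm r :=
      intervalIntegral.integral_mono_on hτ.le (continuous_const.intervalIntegrable _ _) hint
        fun r hr => hanti hr.2
    rw [intervalIntegral.integral_const, smul_eq_mul, sub_zero] at hlow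
    have hup := hR τ hτ.le
    have h1 : τ * ρm τ ≤ R := hlow.trans hup
    -- `τ = 2R + 1`: if `ρm τ > 1/2` then `τ ρm τ > R + 1/2`
    nlinarith [h1, hR0, hnn τ]
  -- a quartered release of `h` from time `0`, for every `j`
  have hbound : ∀ j, 3 / 4 * Torus.scalarL2Sq h ≤
      ν j * (2 * τ * Real.exp (2 * Λ₀ * τ) * Torus.scalarGradNormSq h) := by
    intro j
    obtain ⟨φ, hφ, hφ0⟩ := ColdStartVariance.exists_release (hν j) hτ (hv j) (hdiv j) le_rfl hh
    have hab : (0 : ℝ) < 0 + τ := by linarith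
    have hdec := hDecay j 0 (0 + τ) le_rfl φ hφ hφ0 (0 + τ) ⟨hab.le, le_rfl⟩
    have hq : Torus.scalarL2Sq (φ (0 + τ)) ≤ 4⁻¹ * Torus.scalarL2Sq (φ 0) := by
      rw [hφ0]
      have hsq : ρm (0 + τ - 0) ^ 2 ≤ 4⁻¹ := by
        rw [show (0 : ℝ) + τ - 0 = τ by ring]
        nlinarith [hρτ, hnn τ]
      calc Torus.scalarL2Sq (φ (0 + τ)) ≤ ρm (0 + τ - 0) ^ 2 * Torus.scalarL2Sq h := hdec
        _ ≤ 4⁻¹ * Torus.scalarL2Sq h := mul_le_mul_of_nonneg_right hsq hh_pos.le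
    have hLip' : ∀ t ∈ Icc (0 : ℝ) (0 + τ), ∀ (x : UnitAddTorus (Fin 2)) (ξ : EuclideanSpace ℝ (Fin 2)),
        |⟪ξ, Torus.fderiv (v j t) x ξ⟫_ℝ| ≤ Λ₀ * ‖ξ‖ ^ 2 := fun t ht => hLip j t ht.1
    have := quartering_lipschitz_floor (hν j).le hab hΛ₀ hφ hLip' hτ.le le_rfl hq
    rw [hφ0] at this
    linarith
  -- let `j → ∞`
  have hlim : Tendsto (fun j => ν j * (2 * τ * Real.exp (2 * Λ₀ * τ) * Torus.scalarGradNormSq h))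
      atTop (𝓝 0) := by
    simpa using hν0.mul_const (2 * τ * Real.exp (2 * Λ₀ * τ) * Torus.scalarGradNormSq h)
  have hle : 3 / 4 * Torus.scalarL2Sq h ≤ 0 :=
    ge_of_tendsto hlim (Eventually.of_forall hbound)
  linarith

/-- **Registered tool stub `stub_releaseL2Floor`** (`ledger workitem stub-add stmt-AnomalousDissipation-0448
--name stub_releaseL2Floor`): the signature as registered. [folklore; Poon 1996, Miles–Doering 2018 §2] -/
theorem stub_releaseL2Floor :
    ∀ (κ a b : ℝ) (u : ℝ → UnitAddTorus (Fin 2) → EuclideanSpace ℝ (Fin 2))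
      (φ : ℝ → UnitAddTorus (Fin 2) → ℝ) (Λ : ℝ → ℝ),
      0 ≤ κ → a < b →
      Torus.IsClassicalScalarTransportOn (Set.Icc a b) κ u φ →
      ContinuousOn Λ (Set.Icc a b) →
      (∀ t ∈ Set.Icc a b, ∀ (x : UnitAddTorus (Fin 2)) (ξ : EuclideanSpace ℝ (Fin 2)),
          |inner ℝ ξ (Torus.fderiv (u t) x ξ)| ≤ Λ t * ‖ξ‖ ^ 2) →
      ∀ t ∈ Set.Icc a b,
        Torus.scalarL2Sq (φ a) - 2 * κ * Torus.scalarGradNormSq (φ a) * ∫ r in a..t, Real.exp (2 * ∫ τ in a..r, Λ τ)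
          ≤ Torus.scalarL2Sq (φ t) :=
  fun _ _ _ _ _ _ hκ hab h hΛ hΛb _ ht => scalarL2Sq_sub_le hκ hab h hΛ hΛb ht

end Summit.AnomalousDissipation.AnomalousDissipation.Theorems.ScalarAnomalySteadySourceFormal.ReleaseL2Floor

end
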